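import Mathlib
import HarnessLib
import Summits.ResolutionOfSingularities.ResolutionOfSingularities.Theorems.SurfaceShadowClasses

/-!
# SurfaceShadowKernels — the PROVED kernels of node N55 `SurfaceShadow` (decomp-res lens-4 g11)

Companion of `Theorems.SurfaceShadowClasses` (vocabulary, ports, paper proofs): the elementary corner descent
`noCornerDescent` that ends the SURFACE LAW in Lean, the EXACT class calculus (`nonMonomial_iff_rough`,
`surfaceLeaf_iff`, `rough_iff_leaves`), and the kernels from the ports (`regularSurface_of_surfaceLaw`,
`twoEternal_of_ports`, `hugging_of_g11`, `hugging_iff_g11_leaves`, `ftt_iff_g11_leaves`).  Theses-free; the by-name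
wiring to the `MaxContactCut` asides is `Theorems.MaxContactCutSurfaceShadow`.  All proofs are pure logic over the
stated ports (`[folklore]`).  0 `sorry`.
-/

set_option autoImplicit false

open CategoryTheory AlgebraicGeometry
open Literature.AlgebraicGeometry.Resolution
open Summit.ResolutionOfSingularities.ResolutionOfSingularities.Theorems
open WeakOrderReduction ForcedTowerClasses DivergentTowerClasses MonomialTowerClasses HugDimensionClasses HugDimensionKernels
open SurfaceShadowClasses

namespace Summit.ResolutionOfSingularities.ResolutionOfSingularities.Theorems.SurfaceShadowKernels

/-! ## §1 Elementary kernels -/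

/-- **CORNER DESCENT** (the Lean half of the SURFACE LAW): there is no sequence of exponent pairs `(a j, b j)` with
`N ≤ a j + b j` whose sum drops at every step (`N ≥ 1` is not even needed for the contradiction, but is part of the
certificate the port delivers). [folklore] -/
theorem noCornerDescent {N : ℕ} {a b : ℕ → ℕ} (hab : ∀ j, N ≤ a j + b j)
    (hstep : ∀ j, a (j + 1) + b (j + 1) + 1 ≤ a j + b j) : False := by
  have key : ∀ j, a j + b j + j ≤ a 0 + b 0 := by
    intro j
    induction j with
    | zero => simp
    | succ j ih =>
      have := hstep j
      omega
  have h1 := key (a 0 + b 0 + 1)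
  have h2 := hab (a 0 + b 0 + 1)
  omega

/-! ## §2 Predicates on the tree's `ForcedTower` (g10's = `Theorems.HugDimensionClasses`, imported; `RegularSurfaceHugging`,
`TwoEternal` new) -/

/-- A regular hugged surface germ is a hugged surface germ. [folklore] -/
theorem surfaceHugging_of_regular {T : ForcedTower} (h : RegularSurfaceHugging T) : SurfaceHugging T := by
  obtain ⟨m, H, hH, hdim, -⟩ := h
  exact ⟨m, H, hH, by exact_mod_cast hdim⟩

/-- … hence a hugged germ. [folklore] -/
theorem germHugging_of_regularSurface {T : ForcedTower} (h : RegularSurfaceHugging T) : GermHugging T :=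
  germHugging_of_hugsGermOfDim (surfaceHugging_of_regular h)

/-! ## §3 Tower classes (pieces) and their EXACT calculus -/

/-- Kernel (PROVED): **EXACT `NonMonomial ⟺ (∧ RegS) ∧ Rough`.** [folklore] -/
theorem nonMonomial_iff_rough {n : ℕ} :
    NonMonomialTowersTerminate n ↔
      NoTower n (fun T => ¬ EventuallyMonomial T ∧ RegularSurfaceHugging T) ∧ RoughTowersTerminate n := by
  unfold NonMonomialTowersTerminate RoughTowersTerminate
  rw [noTower_split (fun T => ¬ EventuallyMonomial T) RegularSurfaceHugging]

/-- Kernel (PROVED): **EXACT re-cut of g10's surface leaf: `SurfaceLeaf ⟺ (∧ RegS) ∧ SingularSurfaceLeaf`.** [folklore] -/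
theorem surfaceLeaf_iff {n : ℕ} :
    SurfaceHuggingTowersTerminate n ↔
      NoTower n (fun T => (¬ EventuallyMonomial T ∧ ¬ CurveHugging T ∧ SurfaceHugging T) ∧ RegularSurfaceHugging T) ∧
        SingularSurfaceHuggingTowersTerminate n := by
  unfold SurfaceHuggingTowersTerminate SingularSurfaceHuggingTowersTerminate
  rw [noTower_split (fun T => ¬ EventuallyMonomial T ∧ ¬ CurveHugging T ∧ SurfaceHugging T) RegularSurfaceHugging]
  simp only [and_assoc]

/-- Kernel (PROVED): **EXACT cut of the g11 residual by g10's `w`: `Rough ⟺ (∧ Curve) ∧ SingularSurface ∧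
Hypersurface`**
(a tower hugging no surface germ hugs no regular one). [folklore] -/
theorem rough_iff_leaves {n : ℕ} :
    RoughTowersTerminate n ↔
      NoTower n (fun T => (¬ EventuallyMonomial T ∧ ¬ RegularSurfaceHugging T) ∧ CurveHugging T) ∧
        SingularSurfaceHuggingTowersTerminate n ∧ HypersurfaceHuggingTowersTerminate n := by
  unfold RoughTowersTerminate SingularSurfaceHuggingTowersTerminate HypersurfaceHuggingTowersTerminate
  rw [noTower_split (fun T => ¬ EventuallyMonomial T ∧ ¬ RegularSurfaceHugging T) CurveHugging,
    noTower_split (fun T => (¬ EventuallyMonomial T ∧ ¬ RegularSurfaceHugging T) ∧ ¬ CurveHugging T) SurfaceHugging]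
  refine and_congr Iff.rfl (and_congr ?_ ?_)
  · exact ⟨noTower_mono fun _ h => ⟨⟨⟨h.1, h.2.2.2⟩, h.2.1⟩, h.2.2.1⟩,
      noTower_mono fun _ h => ⟨h.1.1.1, h.1.2, h.2, h.1.1.2⟩⟩
  · exact ⟨noTower_mono fun _ h => ⟨⟨⟨h.1, fun hR => h.2.2 (surfaceHugging_of_regular hR)⟩, h.2.1⟩, h.2.2⟩,
      noTower_mono fun _ h => ⟨h.1.1.1, h.1.2, h.2⟩⟩

/-- The residual from its leaves, with the curve piece in its natural form. [folklore] -/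
theorem rough_of_leaves {n : ℕ} (hC : CurveHuggingTowersTerminate n) (hS : SingularSurfaceHuggingTowersTerminate n)
    (hH : HypersurfaceHuggingTowersTerminate n) : RoughTowersTerminate n :=
  rough_iff_leaves.mpr ⟨noTower_mono (fun _ h => h.2) hC, hS, hH⟩

/-- g10's residual from the g11 pieces. [folklore] -/
theorem nonMonomial_of_g11 {n : ℕ} (hR : RegularSurfaceHuggingTowersTerminate n) (h : RoughTowersTerminate n) :
    NonMonomialTowersTerminate n :=
  nonMonomial_iff_rough.mpr ⟨noTower_mono (fun _ h => h.2) hR, h⟩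

/-- g10's surface leaf from the g11 pieces. [folklore] -/
theorem surfaceLeaf_of_g11 {n : ℕ} (hR : RegularSurfaceHuggingTowersTerminate n)
    (hS : SingularSurfaceHuggingTowersTerminate n) : SurfaceHuggingTowersTerminate n :=
  surfaceLeaf_iff.mpr ⟨noTower_mono (fun _ h => h.2) hR, hS⟩

/-- INCLUSION: two eternal components ⊆ regular-surface hugging ∪ curve hugging (mod `TwoEternalSurface`),
see §5. [folklore] -/
theorem twoEternal_mono {n : ℕ} (h : NoTower n fun T => RegularSurfaceHugging T ∨ CurveHugging T)
    (hTE : ∀ T : ForcedTower, TwoEternal T → RegularSurfaceHugging T ∨ CurveHugging T) : TwoEternalTowersTerminate n :=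
  noTower_mono (fun T hT => hTE T hT) h

/-- Necessity, port-free: every g11 piece is implied by the hugging piece (31570 at marking `n`). [folklore] -/
theorem pieces_of_hugging {n : ℕ} (h : HuggingTowersTerminate n) :
    RegularSurfaceHuggingTowersTerminate n ∧ SingularSurfaceHuggingTowersTerminate n ∧
      NoTower n (fun T => GermHugging T ∧ ¬ EventuallyMonomial T ∧ ¬ RegularSurfaceHugging T) := by
  refine ⟨noTower_mono (fun _ hR => germHugging_of_regularSurface hR) h,
    noTower_mono (fun _ hS => germHugging_of_hugsGermOfDim hS.2.2.1) h, noTower_mono (fun _ hS => hS.1) h⟩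

/-- Necessity, port-free: every g11 piece is implied by the tower piece. [folklore] -/
theorem pieces_of_ftt {n : ℕ} (h : ForcedTowersTerminate n) :
    RegularSurfaceHuggingTowersTerminate n ∧ TwoEternalTowersTerminate n ∧ SingularSurfaceHuggingTowersTerminate n ∧
      RoughTowersTerminate n ∧ HypersurfaceHuggingTowersTerminate n := by
  have h' := forcedTowersTerminate_iff_noTower.mp h
  exact ⟨noTower_mono (fun _ _ => trivial) h', noTower_mono (fun _ _ => trivial) h',
    noTower_mono (fun _ _ => trivial) h', noTower_mono (fun _ _ => trivial) h', noTower_mono (fun _ _ => trivial) h'⟩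

/-! ## §5 Kernels (PROVED, 0 sorry) -/

/-- **THE g11 PIECE IS DECIDED modulo `SurfaceLaw`** (the corner descent is done here). [folklore] -/
theorem regularSurface_of_surfaceLaw {n : ℕ} (hL : SurfaceLaw n) : RegularSurfaceHuggingTowersTerminate n := by
  intro p hp k _ _ T g hB hD hE hR
  obtain ⟨N, a, b, -, hab, hstep⟩ := hL p hp k T g hB hD hE hR
  exact noCornerDescent hab hstep

/-- **No tower has two eternal own components**, modulo `TwoEternalSurface` + `SurfaceLaw` + `CurveLaw`. [folklore] -/
theorem twoEternal_of_ports {n : ℕ} (hT : TwoEternalSurface n) (hL : SurfaceLaw n) (hC : CurveLaw n) :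
    TwoEternalTowersTerminate n := by
  intro p hp k _ _ T g hB hD hE h2
  rcases hT p hp k T g hB hD hE h2 with hR | hCu
  · exact regularSurface_of_surfaceLaw hL p hp k T g hB hD hE hR
  · exact curve_of_curveLaw hC p hp k T g hB hD hE hCu

/-- g10's surface leaf from `SurfaceLaw` and the singular-surface leaf. [folklore] -/
theorem surfaceLeaf_of_surfaceLaw {n : ℕ} (hL : SurfaceLaw n) (hS : SingularSurfaceHuggingTowersTerminate n) :
    SurfaceHuggingTowersTerminate n :=
  surfaceLeaf_of_g11 (regularSurface_of_surfaceLaw hL) hS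

/-- The singular-surface leaf from its port shape. [folklore] -/
theorem singularSurface_of_uniformization {n : ℕ} (hU : SurfaceUniformization n) :
    SingularSurfaceHuggingTowersTerminate n :=
  fun p hp k _ _ T g hB hD hE h => h.2.2.2 (hU p hp k T g hB hD hE h.1 h.2.1 h.2.2.1)

/-- g10's residual from the g10 curve law, the g11 surface law and the two residual leaves. [folklore] -/
theorem nonMonomial_of_ports {n : ℕ} (hC : CurveLaw n) (hL : SurfaceLaw n)
    (hS : SingularSurfaceHuggingTowersTerminate n) (hH : HypersurfaceHuggingTowersTerminate n) :
    NonMonomialTowersTerminate n :=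
  nonMonomial_of_g11 (regularSurface_of_surfaceLaw hL) (rough_of_leaves (curve_of_curveLaw hC) hS hH)

/-- The hugging piece (31570 at marking `n`) from the monomial class and g10's residual (port-free split). [folklore] -/
theorem hugging_of_monomial_nonMonomial {n : ℕ} (hMo : MonomialTowersTerminate n) (hN : NonMonomialTowersTerminate n) :
    HuggingTowersTerminate n := by
  intro p hp k _ _ T g hB hD hE _
  by_cases hMon : EventuallyMonomial T
  · exact hMo p hp k T g hB hD hE hMon
  · exact hN p hp k T g hB hD hE hMon

/-- The tower piece likewise. [folklore] -/
theorem ftt_of_monomial_nonMonomial {n : ℕ} (hMo : MonomialTowersTerminate n) (hN : NonMonomialTowersTerminate n) :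
    ForcedTowersTerminate n := by
  rw [forcedTowersTerminate_iff_noTower]
  intro p hp k _ _ T g hB hD hE _
  by_cases hMon : EventuallyMonomial T
  · exact hMo p hp k T g hB hD hE hMon
  · exact hN p hp k T g hB hD hE hMon

/-- **31570 at marking `n` from the g10/g11 ports and the two residual leaves.** [folklore] -/
theorem hugging_of_g11 {n : ℕ} (hM : MonomialCorner n) (hK : ∀ d : ℕ, d ≤ 4 → NoCornerTower d n) (hC : CurveLaw n)
    (hL : SurfaceLaw n) (hS : SingularSurfaceHuggingTowersTerminate n) (hH : HypersurfaceHuggingTowersTerminate n) :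
    HuggingTowersTerminate n :=
  hugging_of_monomial_nonMonomial (monomial_of_ports hM hK) (nonMonomial_of_ports hC hL hS hH)

/-- (g10) `¬ GermHugging → EventuallyMonomial` at the class level: necessity of the hypersurface leaf from the hugging
piece needs the g10 port `TransversalMonomial` (`HugDimensionClasses`); port-free from the tower piece. [folklore] -/
theorem leaves_of_hugging {n : ℕ} (hTM : TransversalMonomial n) (h : HuggingTowersTerminate n) :
    RegularSurfaceHuggingTowersTerminate n ∧ SingularSurfaceHuggingTowersTerminate n ∧
      HypersurfaceHuggingTowersTerminate n ∧ RoughTowersTerminate n := by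
  have hN : NonMonomialTowersTerminate n := by
    intro p hp k _ _ T g hB hD hE hMon
    by_cases hG : GermHugging T
    · exact h p hp k T g hB hD hE hG
    · exact hMon (hTM p hp k T g hB hD hE hG)
  have hR := nonMonomial_iff_rough.mp hN
  exact ⟨(pieces_of_hugging h).1, (pieces_of_hugging h).2.1, (rough_iff_leaves.mp hR.2).2.2, hR.2⟩

/-- **EXACT at the residual level, modulo the decided pieces and `TransversalMonomial`:
`HuggingTowersTerminate n ⟺ SingularSurface-leaf ∧ Hypersurface-leaf`.** [folklore] -/
theorem hugging_iff_g11_leaves {n : ℕ} (hTM : TransversalMonomial n) (hM : MonomialCorner n)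
    (hK : ∀ d : ℕ, d ≤ 4 → NoCornerTower d n) (hC : CurveLaw n) (hL : SurfaceLaw n) :
    HuggingTowersTerminate n ↔ SingularSurfaceHuggingTowersTerminate n ∧ HypersurfaceHuggingTowersTerminate n :=
  ⟨fun h => ⟨(leaves_of_hugging hTM h).2.1, (leaves_of_hugging hTM h).2.2.1⟩,
    fun h => hugging_of_g11 hM hK hC hL h.1 h.2⟩

/-- **EXACT, port-free on the necessity side: `ForcedTowersTerminate n ⟺ SingularSurface-leaf ∧ Hypersurface-leaf`
modulo `MonomialCorner` + combinatorial leaf + `CurveLaw` + `SurfaceLaw`.** [folklore] -/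
theorem ftt_iff_g11_leaves {n : ℕ} (hM : MonomialCorner n) (hK : ∀ d : ℕ, d ≤ 4 → NoCornerTower d n)
    (hC : CurveLaw n) (hL : SurfaceLaw n) :
    ForcedTowersTerminate n ↔ SingularSurfaceHuggingTowersTerminate n ∧ HypersurfaceHuggingTowersTerminate n :=
  ⟨fun h => ⟨(pieces_of_ftt h).2.2.1, (pieces_of_ftt h).2.2.2.2⟩,
    fun h => ftt_of_monomial_nonMonomial (monomial_of_ports hM hK) (nonMonomial_of_ports hC hL h.1 h.2)⟩

end Summit.ResolutionOfSingularities.ResolutionOfSingularities.Theorems.SurfaceShadowKernels
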